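import Literature.Analysis.SegalBargmann.HeisenbergRealUniqueness
import Literature.Geometry.Symplectic.GromovR4RelEndProofs
import HarnessLib

/-!
# Uniqueness of the irreducible unitary `𝐞`-representation of a real Heisenberg group `Heisenberg B` in symplectic coordinates (von Neumann 1931; Folland 1989 Thm (1.50))

Topic `Analysis/SegalBargmann`; namespace `Literature.Analysis.SegalBargmann`.

`HeisenbergRealUniqueness` proves the Stone–von Neumann uniqueness theorem for the polarised model group
`HeisR σ = Heisenberg (polar (dotPairing σ))`.  The Heisenberg groups that occur at an archimedean place of a number field
([GelbartRogawski1991, §3.1 p. 454 L17–21]: `H(W) = W ⊕ F` for a symplectic `(W, φ)`, law fixed "as usual") are the tree's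
`Heisenberg B` for a real vector space `X` and a bilinear form `B` whose commutator form `s(y, y') = B(y, y') − B(y', y)`
is a non-degenerate alternating form; by a Darboux basis such an `s` has SYMPLECTIC COORDINATES
`e : X ≃ₗ[ℝ] ℝ^σ × ℝ^σ`, `s(y, y') = p·q' − p'·q`.  This file proves the uniqueness theorem for every `Heisenberg B`,
first GIVEN symplectic coordinates `e` (§1–§3; the law `B` itself is arbitrary — polarised, symmetric `½φ`, …), then
with `e` supplied by the linear Darboux theorem (§4):

* §1 `rep_mk_eq_fourierChar_smul` (`π(y, t) = 𝐞(t) π(y, 0)`), the Weyl system `weylOfRepCoords`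
  (`W(x) = 𝐞(½ B(y,y)) π(y, 0)`, `y = e⁻¹ x`) and **`isWeylSystem_weylOfRepCoords`** over
  `(EuclideanSpace ℝ (σ ⊕ σ), Jrot σ)`;
* §2 the forced coefficient **`exists_norm_eq_one_inner_apply_eq_coords`**: every unitary `𝐞`-representation of
  `Heisenberg B` with continuous orbit maps on `E ≠ 0` has a unit vector `v` with
  `⟪π(y, t) v, v⟫ = vacuumCoeffCoords σ B e y t = conj 𝐞(t) · 𝐞(½ B(y,y)) · e^{-(π/2)‖e y‖²}`;
* §3 **`exists_linearIsometryEquiv_of_irreducible_coords`**: any two irreducible such representations are unitarily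
  equivalent (GNS rigidity, `Unitary/CyclicCoefficientRigidity`);
* §4 `exists_symplecticCoords` (linear Darboux, via the tree's `Geometry.Symplectic.exists_symplecticBasis`) and the
  hypothesis-free **`exists_linearIsometryEquiv_of_irreducible_heisenberg`**: for EVERY law `B` with non-degenerate
  commutator form on a finite-dimensional real normed space, irreducible unitary `𝐞`-representations of
  `Heisenberg B` with continuous orbit maps are unique up to unitary equivalence.

Everything is PROVED (Mathlib + tree); no cited statement is used as a hypothesis.

## References

* [vonNeumann1931] J. von Neumann, Die Eindeutigkeit der Schrödingerschen Operatoren, Math. Ann. 104 (1931)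
  570–578, §4.
* [Folland1989] G. B. Folland, *Harmonic Analysis in Phase Space*, Princeton University Press, 1989, §1.1
  Prop. (1.10) (symplectic bases), §1.3 (1.25), §1.5 Theorem (1.50) (doi:10.1515/9781400882427).
* [GelbartRogawski1991] S. Gelbart, J. Rogawski, Invent. Math. 105 (1991), §3.1 p. 454 L17–21.
-/

noncomputable section

open MeasureTheory Complex
open scoped InnerProductSpace ComplexConjugate FourierTransform

namespace Literature.Analysis.SegalBargmann

open Literature.RepresentationTheory.HeisenbergGroup Literature.RepresentationTheory.Unitary

set_option autoImplicit false

variable (σ : Type*) [Fintype σ]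
variable {X : Type*} [NormedAddCommGroup X] [NormedSpace ℝ X]
variable {E : Type*} [NormedAddCommGroup E] [InnerProductSpace ℂ E]

/-! ## 1. The Weyl system of a representation of `Heisenberg B` in symplectic coordinates -/

section Weyl

variable (B : X →ₗ[ℝ] X →ₗ[ℝ] ℝ) (e : X ≃ₗ[ℝ] (σ → ℝ) × (σ → ℝ))
variable (ρ : Representation ℂ (Heisenberg B) E) (hρu : ∀ (h : Heisenberg B) (v : E), ‖ρ h v‖ = ‖v‖)

/-- `π(h)` as a bounded operator (it is an isometry). [cite: Folland1989, §1.3 (1.25)] -/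
def repCLMOf (h : Heisenberg B) : E →L[ℂ] E :=
  LinearMap.mkContinuous (ρ h) 1 fun v => by rw [one_mul, hρu]

/-- unfolding. [cite: Folland1989, §1.3 (1.25)] -/
@[simp] theorem repCLMOf_apply (h : Heisenberg B) (v : E) : repCLMOf B ρ hρu h v = ρ h v := rfl

/-- **The Weyl system of `π` in the symplectic coordinates `e`**: `W(x) = 𝐞(½ B(y,y)) π(y, 0)` with `y = e⁻¹(p,q)`
for `x = (p,q)`. [cite: Folland1989, §1.3 (1.25), §1.5 Theorem (1.50)] -/
def weylOfRepCoords (x : PhaseSpace σ) : E →L[ℂ] E :=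
  ((𝐞 (B (e.symm (phaseEquiv σ x)) (e.symm (phaseEquiv σ x)) / 2) : Circle) : ℂ) •
    repCLMOf B ρ hρu ⟨e.symm (phaseEquiv σ x), 0⟩

omit [Fintype σ] in
/-- unfolding. [cite: Folland1989, §1.3 (1.25)] -/
theorem weylOfRepCoords_apply (x : PhaseSpace σ) (v : E) :
    weylOfRepCoords σ B e ρ hρu x v = ((𝐞 (B (e.symm (phaseEquiv σ x)) (e.symm (phaseEquiv σ x)) / 2) : Circle) : ℂ) •
      ρ ⟨e.symm (phaseEquiv σ x), 0⟩ v := rfl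

variable {σ B e ρ}

omit [Fintype σ] in
/-- With central character `𝐞`: `π(y, t) = 𝐞(t) • π(y, 0)`. [cite: Folland1989, §1.3 (1.25)] -/
theorem rep_mk_eq_fourierChar_smul
    (hρz : ∀ (t : ℝ) (v : E), ρ (Heisenberg.ofCenter B (Multiplicative.ofAdd t)) v = ((𝐞 t : Circle) : ℂ) • v)
    (y : X) (t : ℝ) (v : E) : ρ ⟨y, t⟩ v = ((𝐞 t : Circle) : ℂ) • ρ ⟨y, 0⟩ v := by
  rw [← Heisenberg.ofVec_mul_ofCenter, map_mul, Module.End.mul_apply, hρz, map_smul]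
  rfl

variable {hρu}
variable [FiniteDimensional ℝ X]

/-- **A unitary `𝐞`-representation of `Heisenberg B` with continuous orbit maps is, in symplectic coordinates, a Weyl
system** over `(EuclideanSpace ℝ (σ ⊕ σ), J)`: the commutator form `B(y,y') − B(y',y)` is carried by `e` to the
standard symplectic form `⟪x, J x'⟫ = p·q' − p'·q`. [cite: Folland1989, §1.1 Prop. (1.10), §1.3 (1.25), §1.5 Theorem (1.50)] -/
theorem isWeylSystem_weylOfRepCoords
    (he : ∀ y y' : X, B y y' - B y' y = (e y).1 ⬝ᵥ (e y').2 - (e y').1 ⬝ᵥ (e y).2)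
    (hρc : ∀ v : E, Continuous fun y : X => ρ ⟨y, 0⟩ v)
    (hρz : ∀ (t : ℝ) (v : E), ρ (Heisenberg.ofCenter B (Multiplicative.ofAdd t)) v = ((𝐞 t : Circle) : ℂ) • v) :
    IsWeylSystem (Jrot σ) (weylOfRepCoords σ B e ρ hρu) where
  inner_J_left := inner_Jrot_left σ
  norm_J := norm_Jrot σ
  mul x x' u := by
    set y : X := e.symm (phaseEquiv σ x) with hy
    set y' : X := e.symm (phaseEquiv σ x') with hy'
    have hexy : e.symm (phaseEquiv σ (x + x')) = y + y' := by rw [map_add, map_add]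
    have hmul : ρ ⟨y, 0⟩ (ρ ⟨y', 0⟩ u) = ((𝐞 (B y y') : Circle) : ℂ) • ρ ⟨y + y', 0⟩ u := by
      rw [← Module.End.mul_apply, ← map_mul, Heisenberg.mk_mul_mk]
      simp only [zero_add]
      exact rep_mk_eq_fourierChar_smul hρz _ _ _
    have hs : ⟪x, Jrot σ x'⟫_ℝ = B y y' - B y' y := by
      rw [inner_Jrot_right, he, hy, hy', LinearEquiv.apply_symm_apply, LinearEquiv.apply_symm_apply]
    rw [weylOfRepCoords_apply, weylOfRepCoords_apply, weylOfRepCoords_apply, ← hy, ← hy', map_smul, hmul,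
      smul_smul, smul_smul, smul_smul, fourierChar_coe_mul, fourierChar_coe_mul, fourierChar_coe_mul, hexy, hs]
    congr 3
    simp only [map_add, LinearMap.add_apply]
    ring
  norm_map x u := by
    rw [weylOfRepCoords_apply, norm_smul, Circle.norm_coe, one_mul, hρu]
  continuous u := by
    simp only [weylOfRepCoords_apply]
    have hec : Continuous (e.symm : (σ → ℝ) × (σ → ℝ) → X) :=
      e.symm.toLinearMap.continuous_of_finiteDimensional
    have hy : Continuous fun x : PhaseSpace σ => e.symm (phaseEquiv σ x) := hec.comp (continuous_phaseEquiv σ)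
    have hL : Continuous fun y : X => LinearMap.toContinuousLinearMap (B y) :=
      ((LinearMap.toContinuousLinearMap : (X →ₗ[ℝ] ℝ) ≃ₗ[ℝ] (X →L[ℝ] ℝ)).toLinearMap.comp B)
        |>.continuous_of_finiteDimensional
    have hB : Continuous fun y : X => B y y := by
      have h2 : Continuous fun y : X => (LinearMap.toContinuousLinearMap (B y), y) := hL.prodMk continuous_id
      exact (isBoundedBilinearMap_apply (𝕜 := ℝ) (E := X) (F := ℝ)).continuous.comp h2
    have hc : Continuous fun x : PhaseSpace σ =>
        ((𝐞 (B (e.symm (phaseEquiv σ x)) (e.symm (phaseEquiv σ x)) / 2) : Circle) : ℂ) :=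
      (continuous_subtype_val.comp Real.continuous_fourierChar).comp ((hB.comp hy).div_const _)
    exact hc.smul ((hρc u).comp hy)

end Weyl

/-! ## 2. The forced diagonal coefficient -/

/-- **The vacuum coefficient in symplectic coordinates**:
`c(y, t) = conj 𝐞(t) · 𝐞(½ B(y,y)) · e^{-(π/2)‖e y‖²}` (`‖·‖` the Euclidean norm of `ℝ^σ × ℝ^σ`).
[cite: Folland1989, §1.5 proof of Theorem (1.50), (1.72)] -/
def vacuumCoeffCoords (B : X →ₗ[ℝ] X →ₗ[ℝ] ℝ) (e : X ≃ₗ[ℝ] (σ → ℝ) × (σ → ℝ)) (y : X) (t : ℝ) : ℂ :=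
  conj ((𝐞 t : Circle) : ℂ) * ((𝐞 (B y y / 2) : Circle) : ℂ) *
    (RepresentationTheory.HeisenbergGroup.gauss ((phaseEquiv σ).symm (e y)) : ℂ)

section Coeff

variable [FiniteDimensional ℝ X]
variable {E : Type*} [NormedAddCommGroup E] [InnerProductSpace ℂ E] [CompleteSpace E]
variable {B : X →ₗ[ℝ] X →ₗ[ℝ] ℝ} {e : X ≃ₗ[ℝ] (σ → ℝ) × (σ → ℝ)}

variable {σ} in
/-- **Every unitary `𝐞`-representation of `Heisenberg B` with continuous orbit maps on a non-zero Hilbert space has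
a unit vector with diagonal coefficient `vacuumCoeffCoords`** (von Neumann's Gaussian projection applied to its Weyl
system in symplectic coordinates). [cite: vonNeumann1931, §4; Folland1989, §1.5 Theorem (1.50)] -/
theorem exists_norm_eq_one_inner_apply_eq_coords [Nontrivial E]
    (he : ∀ y y' : X, B y y' - B y' y = (e y).1 ⬝ᵥ (e y').2 - (e y').1 ⬝ᵥ (e y).2)
    (ρ : Representation ℂ (Heisenberg B) E) (hρu : ∀ (h : Heisenberg B) (v : E), ‖ρ h v‖ = ‖v‖)
    (hρc : ∀ v : E, Continuous fun y : X => ρ ⟨y, 0⟩ v)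
    (hρz : ∀ (t : ℝ) (v : E), ρ (Heisenberg.ofCenter B (Multiplicative.ofAdd t)) v = ((𝐞 t : Circle) : ℂ) • v) :
    ∃ v : E, ‖v‖ = 1 ∧ ∀ (y : X) (t : ℝ), ⟪ρ ⟨y, t⟩ v, v⟫_ℂ = vacuumCoeffCoords σ B e y t := by
  obtain ⟨v, hv1, -, hcoef⟩ :=
    (isWeylSystem_weylOfRepCoords (σ := σ) (hρu := hρu) he hρc hρz).exists_norm_eq_one_inner_apply_self
  refine ⟨v, hv1, fun y t => ?_⟩
  have h1 := hcoef ((phaseEquiv σ).symm (e y))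
  rw [weylOfRepCoords_apply, LinearEquiv.apply_symm_apply, LinearEquiv.symm_apply_apply, inner_smul_left] at h1
  set c : ℂ := ((𝐞 (B y y / 2) : Circle) : ℂ) with hc
  have hcc : c * conj c = 1 := by
    rw [hc, Complex.mul_conj, Circle.normSq_coe, Complex.ofReal_one]
  have h2 : ⟪ρ ⟨y, 0⟩ v, v⟫_ℂ = c * (RepresentationTheory.HeisenbergGroup.gauss ((phaseEquiv σ).symm (e y)) : ℂ) := by
    rw [← h1, ← mul_assoc, hcc, one_mul]
  rw [rep_mk_eq_fourierChar_smul hρz, inner_smul_left, h2, vacuumCoeffCoords, mul_assoc]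

/-! ## 3. Uniqueness -/

variable {σ} in
/-- **Stone–von Neumann uniqueness for `Heisenberg B` in symplectic coordinates**: any two irreducible unitary
`𝐞`-representations with continuous orbit maps on non-zero Hilbert spaces are unitarily equivalent.
[cite: vonNeumann1931, §4; Folland1989, §1.5 Theorem (1.50)] -/
theorem exists_linearIsometryEquiv_of_irreducible_coords
    (he : ∀ y y' : X, B y y' - B y' y = (e y).1 ⬝ᵥ (e y').2 - (e y').1 ⬝ᵥ (e y).2)
    {E₁ : Type*} [NormedAddCommGroup E₁] [InnerProductSpace ℂ E₁] [CompleteSpace E₁] [Nontrivial E₁]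
    {E₂ : Type*} [NormedAddCommGroup E₂] [InnerProductSpace ℂ E₂] [CompleteSpace E₂] [Nontrivial E₂]
    (ρ₁ : Representation ℂ (Heisenberg B) E₁) (ρ₂ : Representation ℂ (Heisenberg B) E₂)
    (h₁u : ∀ (h : Heisenberg B) (v : E₁), ‖ρ₁ h v‖ = ‖v‖) (h₂u : ∀ (h : Heisenberg B) (v : E₂), ‖ρ₂ h v‖ = ‖v‖)
    (h₁c : ∀ v : E₁, Continuous fun y : X => ρ₁ ⟨y, 0⟩ v)
    (h₂c : ∀ v : E₂, Continuous fun y : X => ρ₂ ⟨y, 0⟩ v)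
    (h₁z : ∀ (t : ℝ) (v : E₁), ρ₁ (Heisenberg.ofCenter B (Multiplicative.ofAdd t)) v = ((𝐞 t : Circle) : ℂ) • v)
    (h₂z : ∀ (t : ℝ) (v : E₂), ρ₂ (Heisenberg.ofCenter B (Multiplicative.ofAdd t)) v = ((𝐞 t : Circle) : ℂ) • v)
    (h₁i : ∀ K : Submodule ℂ E₁, IsClosed (K : Set E₁) → (∀ (h : Heisenberg B), ∀ v ∈ K, ρ₁ h v ∈ K) →
      K = ⊥ ∨ K = ⊤)
    (h₂i : ∀ K : Submodule ℂ E₂, IsClosed (K : Set E₂) → (∀ (h : Heisenberg B), ∀ v ∈ K, ρ₂ h v ∈ K) →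
      K = ⊥ ∨ K = ⊤) :
    ∃ U : E₁ ≃ₗᵢ[ℂ] E₂, ∀ (h : Heisenberg B) (v : E₁), U (ρ₁ h v) = ρ₂ h (U v) := by
  obtain ⟨v₁, hv₁1, hv₁⟩ := exists_norm_eq_one_inner_apply_eq_coords he ρ₁ h₁u h₁c h₁z
  obtain ⟨v₂, hv₂1, hv₂⟩ := exists_norm_eq_one_inner_apply_eq_coords he ρ₂ h₂u h₂c h₂z
  have hv₁0 : v₁ ≠ 0 := by rw [← norm_ne_zero_iff, hv₁1]; exact one_ne_zero
  have hv₂0 : v₂ ≠ 0 := by rw [← norm_ne_zero_iff, hv₂1]; exact one_ne_zero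
  have hcoef : ∀ h : Heisenberg B, ⟪ρ₁ h v₁, v₁⟫_ℂ = ⟪ρ₂ h v₂, v₂⟫_ℂ := fun h => by
    obtain ⟨y, t⟩ := h
    rw [hv₁, hv₂]
  obtain ⟨U, -, hU⟩ := exists_linearIsometryEquiv_of_irreducible ρ₁ ρ₂ h₁u h₂u h₁i h₂i hv₁0 hv₂0 hcoef
  exact ⟨U, hU⟩

end Coeff


/-! ## 4. Symplectic coordinates exist (linear Darboux); the hypothesis-free theorem -/

section Darboux

variable [FiniteDimensional ℝ X]

omit [Fintype σ] in
/-- **Symplectic coordinates** (linear Darboux theorem, through the tree's `Geometry.Symplectic.exists_symplecticBasis`):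
if the commutator form `B(y,y') − B(y',y)` of the law `B` is non-degenerate, there is a linear isomorphism
`e : X ≃ ℝⁿ × ℝⁿ` with `B(y,y') − B(y',y) = p·q' − p'·q`. [cite: Folland1989, §1.1 Prop. (1.10)] -/
theorem exists_symplecticCoords (B : X →ₗ[ℝ] X →ₗ[ℝ] ℝ) (hs : (B - B.flip).Nondegenerate) :
    ∃ (n : ℕ) (e : X ≃ₗ[ℝ] (Fin n → ℝ) × (Fin n → ℝ)),
      ∀ y y' : X, B y y' - B y' y = (e y).1 ⬝ᵥ (e y').2 - (e y').1 ⬝ᵥ (e y).2 := by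
  set s : LinearMap.BilinForm ℝ X := B - B.flip with hs_def
  have hs_apply : ∀ y y' : X, s y y' = B y y' - B y' y := fun y y' => by
    simp [hs_def, LinearMap.sub_apply, LinearMap.flip_apply]
  have hsa : s.IsAlt := fun y => by
    change s y y = 0
    rw [hs_apply, sub_self]
  obtain ⟨n, b, h11, h22, h12⟩ := Geometry.Symplectic.exists_symplecticBasis s hsa hs
  have h21 : ∀ i j, s (b (Sum.inr i)) (b (Sum.inl j)) = -(if j = i then (1 : ℝ) else 0) := fun i j => by
    rw [← hsa.neg_eq, h12]
  refine ⟨n, b.equivFun.trans (LinearEquiv.sumArrowLequivProdArrow (Fin n) (Fin n) ℝ ℝ), fun y y' => ?_⟩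
  set c : Fin n ⊕ Fin n → ℝ := b.equivFun y with hc
  set c' : Fin n ⊕ Fin n → ℝ := b.equivFun y' with hc'
  have hy : y = ∑ a, c a • b a := (b.sum_equivFun y).symm
  have hy' : y' = ∑ a, c' a • b a := (b.sum_equivFun y').symm
  have hL : B y y' - B y' y = ∑ i, c (Sum.inl i) * c' (Sum.inr i) - ∑ i, c (Sum.inr i) * c' (Sum.inl i) := by
    rw [← hs_apply]
    conv_lhs => rw [hy, hy']
    simp only [map_sum, map_add, LinearMap.add_apply, LinearMap.sum_apply, map_smul, LinearMap.smul_apply,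
      smul_eq_mul, Fintype.sum_sum_type, h11, h22, h12, h21, mul_zero, Finset.sum_const_zero, add_zero, zero_add,
      mul_ite, mul_one, mul_neg, Finset.sum_ite_eq, Finset.sum_ite_eq', Finset.mem_univ, if_true,
      Finset.sum_neg_distrib]
    rw [show (∑ x, c' (Sum.inl x) * c (Sum.inr x)) = ∑ x, c (Sum.inr x) * c' (Sum.inl x) from
        Finset.sum_congr rfl fun x _ => mul_comm _ _,
      show (∑ x, c' (Sum.inr x) * c (Sum.inl x)) = ∑ x, c (Sum.inl x) * c' (Sum.inr x) from
        Finset.sum_congr rfl fun x _ => mul_comm _ _]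
    ring
  have hR1 : ((b.equivFun.trans (LinearEquiv.sumArrowLequivProdArrow (Fin n) (Fin n) ℝ ℝ)) y).1 ⬝ᵥ
      ((b.equivFun.trans (LinearEquiv.sumArrowLequivProdArrow (Fin n) (Fin n) ℝ ℝ)) y').2 =
        ∑ i, c (Sum.inl i) * c' (Sum.inr i) := by
    simp only [dotProduct, LinearEquiv.trans_apply, LinearEquiv.sumArrowLequivProdArrow_apply_fst,
      LinearEquiv.sumArrowLequivProdArrow_apply_snd, hc, hc']
  have hR2 : ((b.equivFun.trans (LinearEquiv.sumArrowLequivProdArrow (Fin n) (Fin n) ℝ ℝ)) y').1 ⬝ᵥ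
      ((b.equivFun.trans (LinearEquiv.sumArrowLequivProdArrow (Fin n) (Fin n) ℝ ℝ)) y).2 =
        ∑ i, c (Sum.inr i) * c' (Sum.inl i) := by
    simp only [dotProduct, LinearEquiv.trans_apply, LinearEquiv.sumArrowLequivProdArrow_apply_fst,
      LinearEquiv.sumArrowLequivProdArrow_apply_snd, hc, hc']
    exact Finset.sum_congr rfl fun i _ => mul_comm _ _
  rw [hL, hR1, hR2]

variable {σ} in
/-- **Stone–von Neumann uniqueness for every real Heisenberg group with non-degenerate commutator form**: for a law
`B` on a finite-dimensional real normed space `X` with `B − Bᵀ` non-degenerate, any two irreducible unitary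
`𝐞`-representations of `Heisenberg B` with continuous orbit maps on non-zero Hilbert spaces are unitarily equivalent
(Darboux coordinates `exists_symplecticCoords` + `exists_linearIsometryEquiv_of_irreducible_coords`).
[cite: vonNeumann1931, §4; Folland1989, §1.5 Theorem (1.50)] -/
theorem exists_linearIsometryEquiv_of_irreducible_heisenberg (B : X →ₗ[ℝ] X →ₗ[ℝ] ℝ)
    (hs : (B - B.flip).Nondegenerate)
    {E₁ : Type*} [NormedAddCommGroup E₁] [InnerProductSpace ℂ E₁] [CompleteSpace E₁] [Nontrivial E₁]
    {E₂ : Type*} [NormedAddCommGroup E₂] [InnerProductSpace ℂ E₂] [CompleteSpace E₂] [Nontrivial E₂]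
    (ρ₁ : Representation ℂ (Heisenberg B) E₁) (ρ₂ : Representation ℂ (Heisenberg B) E₂)
    (h₁u : ∀ (h : Heisenberg B) (v : E₁), ‖ρ₁ h v‖ = ‖v‖) (h₂u : ∀ (h : Heisenberg B) (v : E₂), ‖ρ₂ h v‖ = ‖v‖)
    (h₁c : ∀ v : E₁, Continuous fun y : X => ρ₁ ⟨y, 0⟩ v)
    (h₂c : ∀ v : E₂, Continuous fun y : X => ρ₂ ⟨y, 0⟩ v)
    (h₁z : ∀ (t : ℝ) (v : E₁), ρ₁ (Heisenberg.ofCenter B (Multiplicative.ofAdd t)) v = ((𝐞 t : Circle) : ℂ) • v)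
    (h₂z : ∀ (t : ℝ) (v : E₂), ρ₂ (Heisenberg.ofCenter B (Multiplicative.ofAdd t)) v = ((𝐞 t : Circle) : ℂ) • v)
    (h₁i : ∀ K : Submodule ℂ E₁, IsClosed (K : Set E₁) → (∀ (h : Heisenberg B), ∀ v ∈ K, ρ₁ h v ∈ K) →
      K = ⊥ ∨ K = ⊤)
    (h₂i : ∀ K : Submodule ℂ E₂, IsClosed (K : Set E₂) → (∀ (h : Heisenberg B), ∀ v ∈ K, ρ₂ h v ∈ K) →
      K = ⊥ ∨ K = ⊤) :
    ∃ U : E₁ ≃ₗᵢ[ℂ] E₂, ∀ (h : Heisenberg B) (v : E₁), U (ρ₁ h v) = ρ₂ h (U v) := by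
  obtain ⟨n, e, he⟩ := exists_symplecticCoords B hs
  exact exists_linearIsometryEquiv_of_irreducible_coords (σ := Fin n) he ρ₁ ρ₂ h₁u h₂u h₁c h₂c h₁z h₂z h₁i h₂i

end Darboux

end Literature.Analysis.SegalBargmann


end
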